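import Summits.AtomisticToContinuum.Crystallization.Theorems.FrustratedLawDichotomyStrainedPatchHomEntryMirrorHcpKit
import Summits.AtomisticToContinuum.Crystallization.Theorems.FrustratedLawDichotomyStrainedPatchHomForceCentredHcp

/-!
# SYMMETRY REDUCTION of the hcp half of `(H)`, part 4: the `D₃ₕ` FUNDAMENTAL DOMAIN — the 60° WEDGE `ξ₀ ≥ 0`, `3 ξ₁² ≤ ξ₀²` (× `ξ₂ ≥ 0`), ×12 —
# and the certificate theorems over it

decomp-a2c hand-2 g29 (crux `AperiodicFrustratedLawGap`, stmt-AtomisticToContinuum-27623; sequel of `…HomEntryMirrorHcpKit`).  The coordinate reflection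
`F₀` and the mirror `S` (normal `h₁`) generate `D₃` on the `(ξ₀, ξ₁)`-plane (mirror lines at `90°`, `150°`, `30° = F₀ S F₀`); with `F₂` this is the full
`A`-site group `D₃ₕ` of ideal hcp.  The transfers `dichotomy_of_flipH` / `dichotomy_of_mirH` therefore reduce the hcp dichotomy for ALL `(U, ξ)` (`U`
self-adjoint positive, `‖U − 1‖ ≤ 1/4`, `‖ξ‖ ≤ 1/4`) to the wedge `ξ₀ ≥ 0`, `3 ξ₁² ≤ ξ₀²`, `ξ₂ ≥ 0` — 1/12 of the shuffle cube (BUDGET-F, critic rows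
1077 / 1083 (D): the hcp certificate count scales with this volume; the factor 3 over hand-2 g23's quarter is load-bearing).

* §6 `wedge_of_image` (the `D₃` choice without trigonometry), ★★ `hcpHalf_of_shufWedge` (the reduction; cases `ξ₁ < 0`: `S`; `ξ₁ > 0`: `F₀ S F₀`);
* §7 the vacuous-leaf verdict `wedgeOut` + soundness, ★★ the generic domain-relative tree theorem `hcpHalf_of_entryTreeWedge`;
* §8 the instance over the verdict of record: `entryLeafOKHCW μ := wedgeOut ∨ entryLeafOKHC μ`, `hcpHalf_of_entryTreeHCW`,
  ★★★ `homFloor_of_entryTrees6RBKP_HCW` / `homFloor_625_of_entryTrees6RBKP_HCW`;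
* §9 kernel smoke test.

Two kernel definitions (one prune, one verdict); 0 sorry; standard axioms; no instances / notation / `#eval`.  `--supports stmt-AtomisticToContinuum-27623`.
-/

namespace Summit.AtomisticToContinuum.Crystallization.Theorems.FrustratedLawDichotomyStrainedPatchHomEntryMirrorHcp

open scoped BigOperators RealInnerProductSpace
open Literature.Analysis.ValidatedNumerics.Numerics
open Summit.AtomisticToContinuum.Crystallization.Theorems.ChargedEnergyGapNegative (E3)
open Summit.AtomisticToContinuum.Crystallization.Theorems.FrustratedLawDichotomySchurCut (effPot w₄₅ ω₄)
open Summit.AtomisticToContinuum.Crystallization.Theorems.FrustratedLawDichotomyAveragingRuleTightFree (TightNearCap BadNearCap)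
open Summit.AtomisticToContinuum.Crystallization.Theorems.FrustratedLawDichotomyExemptAbsorption (ExemptNear)
open Summit.AtomisticToContinuum.Crystallization.Theorems.FrustratedLawDichotomyStrainedPatchHomSplit
open Summit.AtomisticToContinuum.Crystallization.Theorems.FrustratedLawDichotomyStrainedPatchHomCover (shuffle_mem_rootCube)
open Summit.AtomisticToContinuum.Crystallization.Theorems.FrustratedLawDichotomyStrainedPatchHomPrunedPolar (homFloor_of_prunedBoxSums_selfAdjoint)
open Summit.AtomisticToContinuum.Crystallization.Theorems.FrustratedLawDichotomyStrainedPatchHomCertTree (CertTree treeOK treeOK_sound)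
open Summit.AtomisticToContinuum.Crystallization.Theorems.FrustratedLawDichotomyStrainedPatchHomEntryGram
open Summit.AtomisticToContinuum.Crystallization.Theorems.FrustratedLawDichotomyStrainedPatchHomEntryGramHcp (rootCH rootWH)
open Summit.AtomisticToContinuum.Crystallization.Theorems.FrustratedLawDichotomyStrainedPatchHomEntryTable (muRec muRec_ok)
open Summit.AtomisticToContinuum.Crystallization.Theorems.FrustratedLawDichotomyStrainedPatchHomEntrySignKit
  (flipIso flipIso_apply conjIso_selfAdjoint conjIso_pos conjIso_norm_sub_one_le)
open Summit.AtomisticToContinuum.Crystallization.Theorems.FrustratedLawDichotomyStrainedPatchHomEntryFlipHcp (HcpDich hcpDich_of_flip hcpHalf_of_shufSigned)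
open Summit.AtomisticToContinuum.Crystallization.Theorems.FrustratedLawDichotomyStrainedPatchHomEntryMirrorHcpKit (mirIso mirIso_apply dichotomy_of_mirH)
open Summit.AtomisticToContinuum.Crystallization.Theorems.FrustratedLawDichotomyStrainedPatchHomEntryTableP (entryLeafOK6RBKP)
open Summit.AtomisticToContinuum.Crystallization.Theorems.FrustratedLawDichotomyStrainedPatchHomEntryTreeCert (fccHalf_of_entryTree6RBKP)
open Summit.AtomisticToContinuum.Crystallization.Theorems.FrustratedLawDichotomyStrainedPatchHomForceCentredHcp (entryLeafOKHC entryLeafOKHC_sound)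

/-! ## §6. The reduction to the wedge `ξ₀ ≥ 0`, `3 ξ₁² ≤ ξ₀²` (and `ξ₂ ≥ 0`) -/

/-- ★ One mirror step: the dichotomy for `(S U S, S ξ)` gives it for `(U, ξ)`. [folklore] -/
theorem hcpDich_of_mir {m : ℝ} (U : E3 →L[ℝ] E3) (ξ : E3) (hU : ‖U - 1‖ ≤ 1 / 4) (hξ : ‖ξ‖ ≤ 1 / 4)
    (h : HcpDich m ((mirIso : E3 →L[ℝ] E3).comp (U.comp (mirIso.symm : E3 →L[ℝ] E3))) (mirIso ξ)) : HcpDich m U ξ :=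
  dichotomy_of_mirH U ξ hU hξ h

/-- The wedge algebra: for `a ≥ 0`, `b > 0`, `a² < 3 b²` the image `(a/2 + (√3/2) b, (√3/2) a − b/2)` (the mirror across the 30° line,
`F₀ S F₀`) lies in the wedge; for `b < 0` the image `(a/2 − (√3/2) b, −(√3/2) a − b/2)` (the mirror `S`) does. [arithmetic] -/
theorem wedge_of_image (a b : ℝ) (ha : 0 ≤ a) (hb : 0 < b) (hab : a ^ 2 < 3 * b ^ 2) :
    0 ≤ a / 2 + Real.sqrt 3 / 2 * b ∧ 3 * (Real.sqrt 3 / 2 * a - b / 2) ^ 2 ≤ (a / 2 + Real.sqrt 3 / 2 * b) ^ 2 := by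
  have h3 : Real.sqrt 3 * Real.sqrt 3 = 3 := Real.mul_self_sqrt (by norm_num)
  have hs : 0 ≤ Real.sqrt 3 := Real.sqrt_nonneg 3
  have hsb : 0 ≤ Real.sqrt 3 * b := mul_nonneg hs hb.le
  have hsum : 0 < Real.sqrt 3 * b + a := by nlinarith
  have hprod : 0 ≤ (Real.sqrt 3 * b - a) * (Real.sqrt 3 * b + a) := by
    have e : (Real.sqrt 3 * b - a) * (Real.sqrt 3 * b + a) = 3 * b ^ 2 - a ^ 2 := by linear_combination b ^ 2 * h3
    rw [e]; linarith
  have hle : 0 ≤ Real.sqrt 3 * b - a := (mul_nonneg_iff_of_pos_right hsum).1 hprod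
  refine ⟨by positivity, ?_⟩
  have key : (a / 2 + Real.sqrt 3 / 2 * b) ^ 2 - 3 * (Real.sqrt 3 / 2 * a - b / 2) ^ 2 = 2 * a * (Real.sqrt 3 * b - a) := by
    linear_combination (b ^ 2 / 4 - 3 * a ^ 2 / 4) * h3
  nlinarith [mul_nonneg ha hle]

/-- ★★ **REDUCTION TO THE FUNDAMENTAL DOMAIN OF `D₃ₕ` (×12).**  If the hcp dichotomy holds for every self-adjoint positive `U` with `‖U − 1‖ ≤ 1/4` and every
`ξ` with `‖ξ‖ ≤ 1/4` in the WEDGE `0 ≤ ξ₀`, `0 ≤ ξ₂`, `3 ξ₁² ≤ ξ₀²`, it holds for every such `U` and EVERY `ξ` with `‖ξ‖ ≤ 1/4`.  (The group generated by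
`F₀`, `F₂`, `S` is the full `A`-site stabiliser `D₃ₕ` of ideal hcp; `F₀`, `S` generate `D₃` in the `(ξ₀, ξ₁)`-plane with mirror lines at `90°`, `150°`, `30°`.)
[folklore] -/
theorem hcpHalf_of_shufWedge {m : ℝ}
    (h : ∀ (U : E3 →L[ℝ] E3) (ξ : E3), (∀ v w : E3, inner ℝ (U v) w = inner ℝ v (U w)) → (∀ w : E3, 0 ≤ inner ℝ w (U w)) →
      ‖U - 1‖ ≤ 1 / 4 → ‖ξ‖ ≤ 1 / 4 → 0 ≤ ξ 0 → 0 ≤ ξ 2 → 3 * (ξ 1) ^ 2 ≤ (ξ 0) ^ 2 → HcpDich m U ξ) :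
    ∀ (U : E3 →L[ℝ] E3) (ξ : E3), (∀ v w : E3, inner ℝ (U v) w = inner ℝ v (U w)) → (∀ w : E3, 0 ≤ inner ℝ w (U w)) →
      ‖U - 1‖ ≤ 1 / 4 → ‖ξ‖ ≤ 1 / 4 → HcpDich m U ξ := by
  refine hcpHalf_of_shufSigned fun U ξ hsa hpos hU hξ h0 h2 => ?_
  -- data of the conjugates under an arbitrary linear isometry
  have cU : ∀ (P : E3 ≃ₗᵢ[ℝ] E3) (V : E3 →L[ℝ] E3), (∀ v w : E3, inner ℝ (V v) w = inner ℝ v (V w)) → (∀ w : E3, 0 ≤ inner ℝ w (V w)) →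
      ‖V - 1‖ ≤ 1 / 4 →
      (∀ v w : E3, inner ℝ (((P : E3 →L[ℝ] E3).comp (V.comp (P.symm : E3 →L[ℝ] E3))) v) w =
        inner ℝ v (((P : E3 →L[ℝ] E3).comp (V.comp (P.symm : E3 →L[ℝ] E3))) w)) ∧
      (∀ w : E3, 0 ≤ inner ℝ w (((P : E3 →L[ℝ] E3).comp (V.comp (P.symm : E3 →L[ℝ] E3))) w)) ∧
      ‖(P : E3 →L[ℝ] E3).comp (V.comp (P.symm : E3 →L[ℝ] E3)) - 1‖ ≤ 1 / 4 :=
    fun P V hVsa hVpos hV => ⟨conjIso_selfAdjoint P hVsa, conjIso_pos P hVpos, (conjIso_norm_sub_one_le P V).trans hV⟩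
  have cξ : ∀ (P : E3 ≃ₗᵢ[ℝ] E3) (η : E3), ‖η‖ ≤ 1 / 4 → ‖P η‖ ≤ 1 / 4 := fun P η hη => by rwa [LinearIsometryEquiv.norm_map]
  have f0 : ∀ η : E3, (flipIso 0 η) 0 = -η 0 ∧ (flipIso 0 η) 1 = η 1 ∧ (flipIso 0 η) 2 = η 2 := fun η => by
    refine ⟨by rw [flipIso_apply]; simp, by rw [flipIso_apply]; simp, by rw [flipIso_apply]; simp⟩
  by_cases hw : 3 * (ξ 1) ^ 2 ≤ (ξ 0) ^ 2
  · exact h U ξ hsa hpos hU hξ h0 h2 hw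
  have hab : (ξ 0) ^ 2 < 3 * (ξ 1) ^ 2 := lt_of_not_ge hw
  have hb0 : ξ 1 ≠ 0 := by intro e; rw [e] at hab; nlinarith [sq_nonneg (ξ 0)]
  rcases lt_or_gt_of_ne hb0 with hb | hb
  · -- `ξ₁ < 0`: one mirror step `S`
    obtain ⟨s1, p1, n1⟩ := cU mirIso U hsa hpos hU
    obtain ⟨m0, m1, m2⟩ := mirIso_apply ξ
    obtain ⟨w0, w1⟩ := wedge_of_image (ξ 0) (-(ξ 1)) h0 (by linarith) (by simpa using hab)
    refine hcpDich_of_mir U ξ hU hξ (h _ _ s1 p1 n1 (cξ mirIso ξ hξ) ?_ ?_ ?_)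
    · rw [m0]; linarith
    · rw [m2]; exact h2
    · rw [m0, m1]
      have e1 : -(Real.sqrt 3 / 2) * ξ 0 - ξ 1 / 2 = -(Real.sqrt 3 / 2 * ξ 0 - -ξ 1 / 2) := by ring
      have e0 : ξ 0 / 2 - Real.sqrt 3 / 2 * ξ 1 = ξ 0 / 2 + Real.sqrt 3 / 2 * -ξ 1 := by ring
      rw [e1, e0, neg_sq]; exact w1
  · -- `ξ₁ > 0`: the mirror across the 30° line, `F₀ ∘ S ∘ F₀` (three transfer steps)
    obtain ⟨s1, p1, n1⟩ := cU (flipIso 0) U hsa hpos hU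
    obtain ⟨s2, p2, n2⟩ := cU mirIso _ s1 p1 n1
    obtain ⟨s3, p3, n3⟩ := cU (flipIso 0) _ s2 p2 n2
    have hξ1 := cξ (flipIso 0) ξ hξ
    have hξ2 := cξ mirIso _ hξ1
    have hξ3 := cξ (flipIso 0) _ hξ2
    obtain ⟨a0, a1, a2⟩ := f0 ξ
    obtain ⟨m0, m1, m2⟩ := mirIso_apply (flipIso 0 ξ)
    obtain ⟨c0, c1, c2⟩ := f0 (mirIso (flipIso 0 ξ))
    obtain ⟨w0, w1⟩ := wedge_of_image (ξ 0) (ξ 1) h0 hb hab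
    refine hcpDich_of_flip (Or.inl rfl) U ξ hU hξ (hcpDich_of_mir _ _ n1 hξ1 (hcpDich_of_flip (Or.inl rfl) _ _ n2 hξ2 (h _ _ s3 p3 n3 hξ3 ?_ ?_ ?_)))
    · rw [c0, m0, a0, a1]
      have e : -(-ξ 0 / 2 - Real.sqrt 3 / 2 * ξ 1) = ξ 0 / 2 + Real.sqrt 3 / 2 * ξ 1 := by ring
      rw [e]; exact w0
    · rw [c2, m2, a2]; exact h2
    · rw [c0, c1, m0, m1, a0, a1]
      have e0 : -(-ξ 0 / 2 - Real.sqrt 3 / 2 * ξ 1) = ξ 0 / 2 + Real.sqrt 3 / 2 * ξ 1 := by ring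
      have e1 : -(Real.sqrt 3 / 2) * -ξ 0 - ξ 1 / 2 = Real.sqrt 3 / 2 * ξ 0 - ξ 1 / 2 := by ring
      rw [e0, e1]; exact w1

/-! ## §7. The wedge prune and the generic tree theorem over the `D₃ₕ` fundamental domain -/

/-- ★ **WEDGE PRUNE**: the box lies outside the wedge throughout — `ξ₀ < 0`, or `ξ₁` has a sign and `3 ξ₁² > ξ₀²` at the extreme corner
(`ξ₀ ≤ hi₀`, `|ξ₁| ≥ min |ξ₁|`); a vacuous leaf on the fundamental domain. -/
def wedgeOut (c w : (Fin 3 × Fin 3) ⊕ Fin 3 → ℤ) : Bool :=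
  decide (c (Sum.inr 0) + w (Sum.inr 0) < 0) ||
  (decide (0 < c (Sum.inr 1) - w (Sum.inr 1)) &&
    decide ((c (Sum.inr 0) + w (Sum.inr 0)) ^ 2 < 3 * (c (Sum.inr 1) - w (Sum.inr 1)) ^ 2)) ||
  (decide (c (Sum.inr 1) + w (Sum.inr 1) < 0) &&
    decide ((c (Sum.inr 0) + w (Sum.inr 0)) ^ 2 < 3 * (c (Sum.inr 1) + w (Sum.inr 1)) ^ 2))

/-- Soundness of the wedge prune. [folklore] -/
theorem false_of_wedgeOut {c w : (Fin 3 × Fin 3) ⊕ Fin 3 → ℤ} (h : wedgeOut c w = true) {ξ : E3}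
    (hξb : ∀ i : Fin 3, |ξ i - (c (Sum.inr i) : ℝ) / SC| ≤ (w (Sum.inr i) : ℝ) / SC) (h0 : 0 ≤ ξ 0) (hw : 3 * (ξ 1) ^ 2 ≤ (ξ 0) ^ 2) :
    False := by
  have hS := SC_pos
  have up : ∀ i : Fin 3, ξ i * SC ≤ (c (Sum.inr i) : ℝ) + w (Sum.inr i) := by
    intro i
    have ha := (abs_le.1 (hξb i)).2
    have : ξ i ≤ ((c (Sum.inr i) : ℝ) + w (Sum.inr i)) / SC := by rw [add_div]; linarith
    rwa [le_div_iff₀ hS] at this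
  have lo : ∀ i : Fin 3, (c (Sum.inr i) : ℝ) - w (Sum.inr i) ≤ ξ i * SC := by
    intro i
    have ha := (abs_le.1 (hξb i)).1
    have : ((c (Sum.inr i) : ℝ) - w (Sum.inr i)) / SC ≤ ξ i := by rw [sub_div]; linarith
    rwa [div_le_iff₀ hS] at this
  have hx0 := up 0
  have h0S : 0 ≤ ξ 0 * SC := mul_nonneg h0 hS.le
  have hwS : 3 * (ξ 1 * SC) ^ 2 ≤ (ξ 0 * SC) ^ 2 :=
    calc 3 * (ξ 1 * SC) ^ 2 = (3 * (ξ 1) ^ 2) * (SC : ℝ) ^ 2 := by ring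
      _ ≤ (ξ 0) ^ 2 * (SC : ℝ) ^ 2 := mul_le_mul_of_nonneg_right hw (sq_nonneg _)
      _ = (ξ 0 * SC) ^ 2 := by ring
  simp only [wedgeOut, Bool.or_eq_true, Bool.and_eq_true, decide_eq_true_eq] at h
  rcases h with (h | ⟨hpos, hlt⟩) | ⟨hneg, hlt⟩
  · have h' : ((c (Sum.inr 0) : ℝ) + w (Sum.inr 0)) < 0 := by exact_mod_cast h
    linarith
  · have hpos' : (0 : ℝ) < (c (Sum.inr 1) : ℝ) - w (Sum.inr 1) := by exact_mod_cast hpos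
    have hlt' : ((c (Sum.inr 0) : ℝ) + w (Sum.inr 0)) ^ 2 < 3 * ((c (Sum.inr 1) : ℝ) - w (Sum.inr 1)) ^ 2 := by exact_mod_cast hlt
    have h1 := lo 1
    nlinarith
  · have hneg' : ((c (Sum.inr 1) : ℝ) + w (Sum.inr 1)) < 0 := by exact_mod_cast hneg
    have hlt' : ((c (Sum.inr 0) : ℝ) + w (Sum.inr 0)) ^ 2 < 3 * ((c (Sum.inr 1) : ℝ) + w (Sum.inr 1)) ^ 2 := by exact_mod_cast hlt
    have h1 := up 1
    nlinarith

/-- ★★ **THE hcp HALF FROM ONE TREE VERDICT OVER THE `D₃ₕ` FUNDAMENTAL DOMAIN** (generic verdict, `hver` relativised to `0 ≤ ξ₀`, `0 ≤ ξ₂`,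
`3 ξ₁² ≤ ξ₀²`): the `hhcp` hypothesis of `…HomPrunedPolar.homFloor_of_prunedBoxSums_selfAdjoint` verbatim, every `m` with `2 (m + e_W) SC ≤ μ`. [folklore] -/
theorem hcpHalf_of_entryTreeWedge {m : ℝ} {μ : ℤ} (hμ : 2 * (m + (-(7175 / 10000) + 3 / 400)) * SC ≤ μ)
    (verdict : ((Fin 3 × Fin 3) ⊕ Fin 3 → ℤ) → ((Fin 3 × Fin 3) ⊕ Fin 3 → ℤ) → Bool)
    (hver : ∀ c w, verdict c w = true → ∀ (U : E3 →L[ℝ] E3) (ξ : E3), (∀ v v' : E3, ⟪U v, v'⟫ = ⟪v, U v'⟫) → ‖U - 1‖ ≤ 1 / 4 →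
      (∀ ab : Fin 3 × Fin 3, |(U (EuclideanSpace.single ab.2 (1 : ℝ))) ab.1 - (c (Sum.inl ab) : ℝ) / SC| ≤ (w (Sum.inl ab) : ℝ) / SC) →
      (∀ i : Fin 3, |ξ i - (c (Sum.inr i) : ℝ) / SC| ≤ (w (Sum.inr i) : ℝ) / SC) → 0 ≤ ξ 0 → 0 ≤ ξ 2 → 3 * (ξ 1) ^ 2 ≤ (ξ 0) ^ 2 →
      (∀ (M : ℕ) (z : Fin M → E3) (c : Fin M), Function.Injective z →
          Set.range z = {x : E3 | dist x (z c) ≤ 133 / 10 ∧ ∃ a : Fin 3 → ℤ,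
            x = z c + latPt U hexFrame a ∨ x = z c + latPt U hexFrame a + U (hcpShift + ξ)} →
          TightNearCap (9 / 5) (3 / 2) z c ∨ ExemptNear (9 / 5) ExRec z c ∨ BadNearCap (9 / 5) (3 / 2) z c) ∨
        (μ : ℝ) / SC ≤ ∑ b ∈ (Fintype.piFinset fun _ : Fin 3 => Finset.Icc (-7 : ℤ) 7).filter (fun b => b ≠ 0), effPot w₄₅ ω₄ (3 / 400) ‖latPt U hexFrame b‖ +
          ∑ b ∈ (Fintype.piFinset fun _ : Fin 3 => Finset.Icc (-7 : ℤ) 7), effPot w₄₅ ω₄ (3 / 400) ‖latPt U hexFrame b + U (hcpShift + ξ)‖)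
    {t : CertTree ((Fin 3 × Fin 3) ⊕ Fin 3)} (h : treeOK verdict t rootCH rootWH = true) :
    ∀ (U : E3 →L[ℝ] E3) (ξ : E3), (∀ v w : E3, inner ℝ (U v) w = inner ℝ v (U w)) → (∀ w : E3, 0 ≤ inner ℝ w (U w)) →
      ‖U - 1‖ ≤ 1 / 4 → ‖ξ‖ ≤ 1 / 4 → HcpDich m U ξ := by
  refine hcpHalf_of_shufWedge fun U ξ hsa _hpos hU hξ hx0 hx2 hxw => ?_
  have hS := SC_pos
  have hroot : ∀ k, |(Sum.elim (fun ab : Fin 3 × Fin 3 => (U (EuclideanSpace.single ab.2 (1 : ℝ))) ab.1) (fun i : Fin 3 => ξ i) k) -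
      (rootCH k : ℝ) / SC| ≤ (rootWH k : ℝ) / SC := by
    intro k
    rcases k with ab | i
    · simpa [rootCH, rootWH, rootW] using mem_root_of_near_one hU ab
    · have h := shuffle_mem_rootCube hξ i
      have e1 : (rootCH (Sum.inr i) : ℝ) / SC = 0 := by simp [rootCH]
      rw [Sum.elim_inr, e1, show (rootWH (Sum.inr i) : ℝ) / SC = 1 / 4 from rootW_div]
      exact h
  have key := treeOK_sound SC_pos
    (P := fun x : (Fin 3 × Fin 3) ⊕ Fin 3 → ℝ => ∀ (U : E3 →L[ℝ] E3) (ξ : E3), (∀ v v' : E3, ⟪U v, v'⟫ = ⟪v, U v'⟫) → ‖U - 1‖ ≤ 1 / 4 →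
      (∀ ab : Fin 3 × Fin 3, (U (EuclideanSpace.single ab.2 (1 : ℝ))) ab.1 = x (Sum.inl ab)) → (∀ i : Fin 3, ξ i = x (Sum.inr i)) →
      0 ≤ ξ 0 → 0 ≤ ξ 2 → 3 * (ξ 1) ^ 2 ≤ (ξ 0) ^ 2 →
      (∀ (M : ℕ) (z : Fin M → E3) (c : Fin M), Function.Injective z →
          Set.range z = {x : E3 | dist x (z c) ≤ 133 / 10 ∧ ∃ a : Fin 3 → ℤ,
            x = z c + latPt U hexFrame a ∨ x = z c + latPt U hexFrame a + U (hcpShift + ξ)} →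
          TightNearCap (9 / 5) (3 / 2) z c ∨ ExemptNear (9 / 5) ExRec z c ∨ BadNearCap (9 / 5) (3 / 2) z c) ∨
        (μ : ℝ) / SC ≤ ∑ b ∈ (Fintype.piFinset fun _ : Fin 3 => Finset.Icc (-7 : ℤ) 7).filter (fun b => b ≠ 0), effPot w₄₅ ω₄ (3 / 400) ‖latPt U hexFrame b‖ +
          ∑ b ∈ (Fintype.piFinset fun _ : Fin 3 => Finset.Icc (-7 : ℤ) 7), effPot w₄₅ ω₄ (3 / 400) ‖latPt U hexFrame b + U (hcpShift + ξ)‖)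
    verdict (fun c w hv x hx V η hVsa hV1 hVx hηx h0 h2 hw => hver c w hv V η hVsa hV1 (fun ab => by rw [hVx ab]; exact hx (Sum.inl ab))
      (fun i => by rw [hηx i]; exact hx (Sum.inr i)) h0 h2 hw) t rootCH rootWH h
    (Sum.elim (fun ab : Fin 3 × Fin 3 => (U (EuclideanSpace.single ab.2 (1 : ℝ))) ab.1) (fun i : Fin 3 => ξ i)) hroot U ξ hsa hU
    (fun _ => rfl) (fun _ => rfl) hx0 hx2 hxw
  refine key.imp id fun hfloor => ?_
  have h2 : 2 * (m + (-(7175 / 10000) + 3 / 400)) ≤ (μ : ℝ) / SC := by rw [le_div_iff₀ hS]; exact hμ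
  linarith

/-! ## §8. The verdict of record over the `D₃ₕ` fundamental domain and `(H) HomFloor m` -/

/-- ★★ **hcp VERDICT OF RECORD OVER THE `D₃ₕ` FUNDAMENTAL DOMAIN**: wedge prune ∨ `entryLeafOKHC μ` (quick verdict ∨ centred exempt prune). -/
def entryLeafOKHCW (μ : ℤ) (c w : (Fin 3 × Fin 3) ⊕ Fin 3 → ℤ) : Bool := wedgeOut c w || entryLeafOKHC μ c w

/-- ★★ The hcp half from ONE certificate tree over `entryLeafOKHCW μ` (search restricted to ×1/12 of the shuffle disc). [folklore] -/
theorem hcpHalf_of_entryTreeHCW {m : ℝ} {μ : ℤ} (hμ : 2 * (m + (-(7175 / 10000) + 3 / 400)) * SC ≤ μ) {t : CertTree ((Fin 3 × Fin 3) ⊕ Fin 3)}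
    (h : treeOK (entryLeafOKHCW μ) t rootCH rootWH = true) :
    ∀ (U : E3 →L[ℝ] E3) (ξ : E3), (∀ v w : E3, inner ℝ (U v) w = inner ℝ v (U w)) → (∀ w : E3, 0 ≤ inner ℝ w (U w)) →
      ‖U - 1‖ ≤ 1 / 4 → ‖ξ‖ ≤ 1 / 4 → HcpDich m U ξ := by
  refine hcpHalf_of_entryTreeWedge hμ (entryLeafOKHCW μ) (fun c w hv U ξ hsa hU hbox hξ h0 h2 hw => ?_) h
  simp only [entryLeafOKHCW, Bool.or_eq_true] at hv
  rcases hv with hv | hv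
  · exact (false_of_wedgeOut hv hξ h0 hw).elim
  · exact entryLeafOKHC_sound hv U ξ hsa hU hbox hξ h0 h2

/-- ★★★ **`(H) HomFloor m` with the ×12 reduction in the tree**: the fcc ∃-tree fact of record (`entryLeafOK6RBKP μ`) and an hcp ∃-tree fact over
`entryLeafOKHCW μ` give `HomFloor m`, every `m`, `μ` with `2(m + e_W)SC ≤ μ`. [folklore] -/
theorem homFloor_of_entryTrees6RBKP_HCW {m : ℝ} {μ : ℤ} (hμ : 2 * (m + (-(7175 / 10000) + 3 / 400)) * SC ≤ μ)
    (hF : ∃ t : CertTree (Fin 3 × Fin 3), treeOK (entryLeafOK6RBKP μ) t rootC rootW = true)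
    (hH : ∃ t : CertTree ((Fin 3 × Fin 3) ⊕ Fin 3), treeOK (entryLeafOKHCW μ) t rootCH rootWH = true) : HomFloor m := by
  obtain ⟨tF, htF⟩ := hF
  obtain ⟨tH, htH⟩ := hH
  exact homFloor_of_prunedBoxSums_selfAdjoint (fccHalf_of_entryTree6RBKP hμ htF) (hcpHalf_of_entryTreeHCW hμ htH)

/-- ★★★ **`(H) HomFloor (1/625)`** over the ×12-reduced hcp verdict of record (`μ = muRec`). [folklore] -/
theorem homFloor_625_of_entryTrees6RBKP_HCW
    (hF : ∃ t : CertTree (Fin 3 × Fin 3), treeOK (entryLeafOK6RBKP muRec) t rootC rootW = true)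
    (hH : ∃ t : CertTree ((Fin 3 × Fin 3) ⊕ Fin 3), treeOK (entryLeafOKHCW muRec) t rootCH rootWH = true) : HomFloor (1 / 625) :=
  homFloor_of_entryTrees6RBKP_HCW muRec_ok hF hH

/-! ## §9. Kernel smoke test -/

/-- The wedge prune fires on a box with `ξ₁ ∈ [0.15, 0.25]`, `ξ₀ ∈ [0, 0.05]` and on its mirror image `ξ₁ ∈ [−0.25, −0.15]`, not on the root cube,
and not on a box inside the wedge (`ξ₀ ∈ [0.15, 0.25]`, `ξ₁ ∈ [0, 0.05]`). -/
example :
    wedgeOut (Function.update (Function.update rootCH (Sum.inr 1) 56294995342131) (Sum.inr 0) 7036874417766) (fun _ => 14073748835533) = true ∧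
    wedgeOut (Function.update (Function.update rootCH (Sum.inr 1) (-56294995342131)) (Sum.inr 0) 7036874417766) (fun _ => 14073748835533) = true ∧
    wedgeOut rootCH rootWH = false ∧
    wedgeOut (Function.update (Function.update rootCH (Sum.inr 0) 56294995342131) (Sum.inr 1) 7036874417766) (fun _ => 14073748835533) = false := by
  decide +kernel

end Summit.AtomisticToContinuum.Crystallization.Theorems.FrustratedLawDichotomyStrainedPatchHomEntryMirrorHcp
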